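import Literature.Analysis.FluidPDE.CompressibleEulerProfileSharpDecay
import HarnessLib

/-!
# The far field of the profile density is non-degenerate: `S(ζ) ≥ c ζ^{1−r}` (theorems only)

Topic `Literature/Analysis/FluidPDE`; namespace `Literature.Analysis.FluidPDE.CaolaboraEtAl2025`.
Sequel of `CompressibleEulerProfileSharpDecay.lean` (the orbit `(𝒰, 𝒮)(ξ) = (U, S)(e^ξ)/e^ξ` is
`O(e^{−rξ})`, i.e. `|U(ζ)|, |S(ζ)| ≤ C ζ^{1−r}`). THEOREMS ONLY, no new facts (D-0026).

Complementing the upper bound of eq. (1.6) of Cao-Labora–Gómez-Serrano–Shi–Staffilani, the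
rescaled sound speed of the profile of the vendored fact
`BuckmasterCaolaboraGomezserrano2025_thm11_monatomic` is bounded BELOW by the same power,
`S(ζ) ≥ c ζ^{1−r}`, `c > 0`, for large `ζ` (`profile_soundSpeed_lower`), so `S ≍ ζ^{1−r}`
(this is the statement "`ρ ≍ (T−t)^{…}`", two-sided, of Thm 1.2 of the source at the level of
the profile; it is what bounds the density of the exact self-similar solution from below away
from the core, polynomially in `T − t`). The mechanism is the continuity equation: in the
logarithmic variable the `𝒮`-equation is LINEAR in `𝒮`,

  `𝒮′ = 𝒮 · (−r + φ(𝒰, 𝒮))`,  `|φ(𝒰, 𝒮)| ≤ 4 ‖(𝒰, 𝒮)‖` near `P_∞`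

(`logVar_snd_linear`, `logField_phi_bound`), and `φ` along the orbit is `O(e^{−rξ})`, integrable;
hence `log 𝒮 + rξ` has bounded variation at infinity and `𝒮(ξ) ≥ c e^{−rξ}` (`logSoundSpeed_lower`).
[cite: CaolaboraEtAl2025, eq. (1.6) p. 6 and Thm 1.2 p. 6 (`ρ ≍ (T−t)^{−(1−1/r)/α}`)]
[cite: BuckmasterCaolaboraGomezserrano2025, Thm 1.1 p. 4 (`S > 0`, `P_∞`)]
-/

noncomputable section

open Set Filter Topology Metric
open scoped ContDiff

namespace Literature.Analysis.FluidPDE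

open Literature.MathematicalPhysics.KineticTheory (V3)

namespace CaolaboraEtAl2025

section Lower

variable {r : ℝ} {U S : ℝ → ℝ}

/-- The `𝒮`-equation is linear in `𝒮`: with `q = 𝒮′` from `logVar_solve`,
`q + r s = s · ψ(u, s)/Δ`, `ψ = s²/9 − rs²/9 − 2u + (4/3)ru − (5/3)u² + ru²`. [folklore] -/
theorem logVar_snd_linear {u s p q : ℝ}
    (h1 : (r - 1) * u + (1 + u) * (u + p) + 1 / 3 * s * (s + q) = 0)
    (h2 : (r - 1) * s + (1 + u) * (s + q) + 1 / 3 * s * (u + p + 2 * u) = 0)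
    (hΔ : (1 + u) ^ 2 - (s / 3) ^ 2 ≠ 0) :
    q + r * s = s * ((1 / 9 * s ^ 2 - 1 / 9 * r * s ^ 2 - 2 * u + 4 / 3 * r * u - 5 / 3 * u ^ 2 +
      r * u ^ 2) / ((1 + u) ^ 2 - (s / 3) ^ 2)) := by
  obtain ⟨-, hq⟩ := logVar_solve h1 h2 hΔ
  rw [hq, div_add' _ _ _ hΔ, ← mul_div_assoc, div_left_inj' hΔ]
  ring

/-- The coefficient `φ = ψ/Δ` of the linear `𝒮`-equation is `O(‖(u, s)‖)` near `P_∞`: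
`|ψ/Δ| ≤ 4 max(|u|, |s|)` for `|u|, |s| ≤ 1/4`, `1 ≤ r ≤ 2`. [folklore] -/
theorem logField_phi_bound {u s : ℝ} (hu : |u| ≤ 1 / 4) (hs : |s| ≤ 1 / 4) (hr1 : 1 ≤ r)
    (hr2 : r ≤ 2) :
    |(1 / 9 * s ^ 2 - 1 / 9 * r * s ^ 2 - 2 * u + 4 / 3 * r * u - 5 / 3 * u ^ 2 + r * u ^ 2) /
        ((1 + u) ^ 2 - (s / 3) ^ 2)| ≤ 4 * max |u| |s| := by
  have hu' := hu
  have hs' := hs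
  rw [abs_le] at hu' hs'
  have hΔ : 1 / 2 ≤ (1 + u) ^ 2 - (s / 3) ^ 2 := by nlinarith
  rw [abs_div, abs_of_pos (show (0 : ℝ) < (1 + u) ^ 2 - (s / 3) ^ 2 by linarith),
    div_le_iff₀ (show (0 : ℝ) < (1 + u) ^ 2 - (s / 3) ^ 2 by linarith)]
  have hm1 : |u| ≤ max |u| |s| := le_max_left _ _
  have hm2 : |s| ≤ max |u| |s| := le_max_right _ _
  have hψ : |1 / 9 * s ^ 2 - 1 / 9 * r * s ^ 2 - 2 * u + 4 / 3 * r * u - 5 / 3 * u ^ 2 + r * u ^ 2|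
      ≤ 2 * max |u| |s| := by
    have e : 1 / 9 * s ^ 2 - 1 / 9 * r * s ^ 2 - 2 * u + 4 / 3 * r * u - 5 / 3 * u ^ 2 + r * u ^ 2
        = s * ((1 - r) / 9 * s) + u * ((4 / 3 * r - 2) + (r - 5 / 3) * u) := by ring
    rw [e]
    have b1 : |(1 - r) / 9 * s| ≤ 1 := by
      rw [abs_mul, abs_div, show |(9 : ℝ)| = 9 by norm_num]
      have : |1 - r| ≤ 1 := by rw [abs_le]; constructor <;> linarith
      nlinarith [abs_nonneg (1 - r), abs_nonneg s]
    have b2 : |(4 / 3 * r - 2) + (r - 5 / 3) * u| ≤ 1 := by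
      refine (abs_add_le _ _).trans ?_
      rw [abs_mul]
      have c1 : |4 / 3 * r - 2| ≤ 2 / 3 := by rw [abs_le]; constructor <;> linarith
      have c2 : |r - 5 / 3| ≤ 2 / 3 := by rw [abs_le]; constructor <;> linarith
      nlinarith [abs_nonneg (r - 5 / 3), abs_nonneg u]
    have t1 : |s * ((1 - r) / 9 * s)| ≤ |s| * 1 := by
      rw [abs_mul]
      exact mul_le_mul_of_nonneg_left b1 (abs_nonneg _)
    have t2 : |u * ((4 / 3 * r - 2) + (r - 5 / 3) * u)| ≤ |u| * 1 := by
      rw [abs_mul]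
      exact mul_le_mul_of_nonneg_left b2 (abs_nonneg _)
    calc |s * ((1 - r) / 9 * s) + u * ((4 / 3 * r - 2) + (r - 5 / 3) * u)|
        ≤ |s * ((1 - r) / 9 * s)| + |u * ((4 / 3 * r - 2) + (r - 5 / 3) * u)| := abs_add_le _ _
      _ ≤ |s| * 1 + |u| * 1 := add_le_add t1 t2
      _ ≤ 2 * max |u| |s| := by linarith
  have hm0 : 0 ≤ max |u| |s| := le_max_of_le_left (abs_nonneg u)
  nlinarith

/-- **The orbit's sound-speed component decays no faster than `e^{−rξ}`:** for profiles as in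
the vendored fact with `S > 0` and `1 < r < 2` there are `a` and `c > 0` with
`𝒮(ξ) = S(e^ξ)/e^ξ ≥ c e^{−rξ}` for `ξ > a` (the `𝒮`-equation is `𝒮′ = 𝒮(−r + φ)` with
`φ = O(‖(𝒰,𝒮)‖) = O(e^{−rξ})` integrable, so `log 𝒮 + rξ` stays bounded below).
[cite: CaolaboraEtAl2025, Thm 1.2 p. 6 (`ρ ≍ …`), eq. (1.6) p. 6] -/
theorem logSoundSpeed_lower (hr1 : 1 < r) (hr2 : r < 2)
    (hU : ContDiff ℝ ∞ fun y : V3 => (U ‖y‖ / ‖y‖) • y) (hS : ContDiff ℝ ∞ fun y : V3 => S ‖y‖)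
    (hode : ∀ ζ : ℝ, 0 < ζ →
      (r - 1) * U ζ + (ζ + U ζ) * deriv U ζ + 1 / 3 * S ζ * deriv S ζ = 0 ∧
      (r - 1) * S ζ + (ζ + U ζ) * deriv S ζ + 1 / 3 * S ζ * (deriv U ζ + 2 * U ζ / ζ) = 0)
    (hSpos : ∀ ζ : ℝ, 0 ≤ ζ → 0 < S ζ)
    (hlimU : Tendsto (fun ζ => U ζ / ζ) atTop (𝓝 0))
    (hlimS : Tendsto (fun ζ => S ζ / ζ) atTop (𝓝 0)) :
    ∃ a c : ℝ, 0 < c ∧ ∀ ξ, a < ξ → c * Real.exp (-r * ξ) ≤ Real.exp (-ξ) * S (Real.exp ξ) := by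
  have hUc : ∀ ζ : ℝ, 0 < ζ → ContDiffAt ℝ ∞ U ζ := fun ζ hζ => contDiffAt_profile_of_radialField hU hζ
  have hSc : ∀ ζ : ℝ, 0 < ζ → ContDiffAt ℝ ∞ S ζ := fun ζ hζ => contDiffAt_profile_of_radialScalar hS hζ
  obtain ⟨W, O, a₁, -, -, -, -, -, horb⟩ := logOrbit_package hr1.le hr2.le hU hS hode hlimU hlimS
  obtain ⟨a₂, C, hC⟩ := logProfile_sharp hr1 hr2 hU hS hode hlimU hlimS
  set 𝒰 : ℝ → ℝ := fun ξ => Real.exp (-ξ) * U (Real.exp ξ) with h𝒰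
  set 𝒮 : ℝ → ℝ := fun ξ => Real.exp (-ξ) * S (Real.exp ξ) with h𝒮
  have h𝒮pos : ∀ ξ, 0 < 𝒮 ξ := fun ξ =>
    mul_pos (Real.exp_pos _) (hSpos _ (Real.exp_pos ξ).le)
  have hU𝒰 : ∀ ξ, U (Real.exp ξ) = Real.exp ξ * 𝒰 ξ := fun ξ => by
    simp only [h𝒰, Real.exp_neg]
    field_simp
  have hS𝒮 : ∀ ξ, S (Real.exp ξ) = Real.exp ξ * 𝒮 ξ := fun ξ => by
    simp only [h𝒮, Real.exp_neg]
    field_simp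
  -- the coefficient along the orbit, and the derivative of `w = log 𝒮 + r ξ`
  set a : ℝ := max a₁ a₂ with ha
  have hball : ∀ ξ, a < ξ → |𝒰 ξ| ≤ 1 / 4 ∧ |𝒮 ξ| ≤ 1 / 4 := by
    intro ξ hξ
    have h := (horb ξ ((le_max_left _ _).trans_lt hξ)).1
    rw [mem_closedBall, dist_zero_right] at h
    have e1 := norm_fst_le (𝒰 ξ, 𝒮 ξ)
    have e2 := norm_snd_le (𝒰 ξ, 𝒮 ξ)
    rw [Real.norm_eq_abs] at e1 e2
    exact ⟨e1.trans h, e2.trans h⟩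
  have hw' : ∀ ξ, a < ξ → ∃ φ : ℝ, |φ| ≤ 4 * ‖(𝒰 ξ, 𝒮 ξ)‖ ∧
      HasDerivAt (fun ξ => Real.log (𝒮 ξ) + r * ξ) φ ξ := by
    intro ξ hξ
    obtain ⟨h1, h2⟩ := hball ξ hξ
    have hΔ : (1 + 𝒰 ξ) ^ 2 - (𝒮 ξ / 3) ^ 2 ≠ 0 := by
      rw [abs_le] at h1 h2
      nlinarith
    have d𝒮 := hasDerivAt_logProfile hSc ξ
    set p : ℝ := -(Real.exp (-ξ) * U (Real.exp ξ)) + deriv U (Real.exp ξ) with hp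
    set q : ℝ := -(Real.exp (-ξ) * S (Real.exp ξ)) + deriv S (Real.exp ξ) with hq
    have hUp : deriv U (Real.exp ξ) = 𝒰 ξ + p := by simp only [hp, h𝒰]; ring
    have hSq : deriv S (Real.exp ξ) = 𝒮 ξ + q := by simp only [hq, h𝒮]; ring
    have hζ := Real.exp_pos ξ
    obtain ⟨E1, E2⟩ := hode _ hζ
    rw [hU𝒰, hS𝒮, hUp, hSq] at E1 E2
    have hdiv : 2 * (Real.exp ξ * 𝒰 ξ) / Real.exp ξ = 2 * 𝒰 ξ := by field_simp
    rw [hdiv] at E2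
    have L1 : (r - 1) * 𝒰 ξ + (1 + 𝒰 ξ) * (𝒰 ξ + p) + 1 / 3 * 𝒮 ξ * (𝒮 ξ + q) = 0 := by
      have h0 : Real.exp ξ * ((r - 1) * 𝒰 ξ + (1 + 𝒰 ξ) * (𝒰 ξ + p) +
          1 / 3 * 𝒮 ξ * (𝒮 ξ + q)) = 0 := by rw [← E1]; ring
      exact (mul_eq_zero.1 h0).resolve_left hζ.ne'
    have L2 : (r - 1) * 𝒮 ξ + (1 + 𝒰 ξ) * (𝒮 ξ + q) +
        1 / 3 * 𝒮 ξ * (𝒰 ξ + p + 2 * 𝒰 ξ) = 0 := by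
      have h0 : Real.exp ξ * ((r - 1) * 𝒮 ξ + (1 + 𝒰 ξ) * (𝒮 ξ + q) +
          1 / 3 * 𝒮 ξ * (𝒰 ξ + p + 2 * 𝒰 ξ)) = 0 := by rw [← E2]; ring
      exact (mul_eq_zero.1 h0).resolve_left hζ.ne'
    have hlin := logVar_snd_linear L1 L2 hΔ
    set φ : ℝ := (1 / 9 * 𝒮 ξ ^ 2 - 1 / 9 * r * 𝒮 ξ ^ 2 - 2 * 𝒰 ξ + 4 / 3 * r * 𝒰 ξ -
        5 / 3 * 𝒰 ξ ^ 2 + r * 𝒰 ξ ^ 2) / ((1 + 𝒰 ξ) ^ 2 - (𝒮 ξ / 3) ^ 2) with hφ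
    refine ⟨φ, ?_, ?_⟩
    · have hb := logField_phi_bound (r := r) h1 h2 hr1.le hr2.le
      rw [Prod.norm_def, Real.norm_eq_abs, Real.norm_eq_abs]
      exact hb
    · have hlog : HasDerivAt (fun ξ => Real.log (𝒮 ξ)) (q / 𝒮 ξ) ξ := by
        have h := (Real.hasDerivAt_log (h𝒮pos ξ).ne').comp ξ d𝒮
        rw [div_eq_inv_mul]
        exact h
      have hsum := hlog.add ((hasDerivAt_id ξ).const_mul r)
      refine hsum.congr_deriv ?_
      have hs0 : 𝒮 ξ ≠ 0 := (h𝒮pos ξ).ne'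
      rw [mul_one, div_add' _ _ _ hs0, hlin, hφ]
      field_simp
  -- fencing: `w ξ ≥ w ξ₀ - D` for `ξ ≥ ξ₀ = a + 1`
  set ξ₀ : ℝ := a + 1 with hξ₀
  have hr0 : 0 < r := by linarith
  set K : ℝ := 4 * |C| with hK
  have hwb : ∀ ξ, a < ξ → ∀ φ : ℝ, |φ| ≤ 4 * ‖(𝒰 ξ, 𝒮 ξ)‖ → |φ| ≤ K * Real.exp (-r * ξ) := by
    intro ξ hξ φ hφ
    have h := hC ξ ((le_max_right _ _).trans_lt hξ)
    have h' : C * Real.exp (-r * ξ) ≤ |C| * Real.exp (-r * ξ) :=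
      mul_le_mul_of_nonneg_right (le_abs_self C) (Real.exp_pos _).le
    calc |φ| ≤ 4 * ‖(𝒰 ξ, 𝒮 ξ)‖ := hφ
      _ ≤ 4 * (|C| * Real.exp (-r * ξ)) := by linarith
      _ = K * Real.exp (-r * ξ) := by rw [hK]; ring
  set w : ℝ → ℝ := fun ξ => Real.log (𝒮 ξ) + r * ξ with hw
  have hwd : ∀ ξ, a < ξ → DifferentiableAt ℝ w ξ := fun ξ hξ => by
    obtain ⟨φ, -, hφ⟩ := hw' ξ hξ
    exact hφ.differentiableAt
  have hderiv_bound : ∀ ξ, a < ξ → ‖deriv w ξ‖ ≤ K * Real.exp (-r * ξ) := by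
    intro ξ hξ
    obtain ⟨φ, hφb, hφ⟩ := hw' ξ hξ
    rw [hφ.deriv, Real.norm_eq_abs]
    exact hwb ξ hξ φ hφb
  set B : ℝ → ℝ := fun x => K / r * (Real.exp (-r * ξ₀) - Real.exp (-r * x)) with hB
  have hB' : ∀ x, HasDerivAt B (K * Real.exp (-r * x)) x := by
    intro x
    have h1 : HasDerivAt (fun x => Real.exp (-r * x)) (Real.exp (-r * x) * -r) x := by
      simpa using ((hasDerivAt_id x).const_mul (-r)).exp
    have h2 := (h1.const_sub (Real.exp (-r * ξ₀))).const_mul (K / r)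
    refine h2.congr_deriv ?_
    field_simp
  have hlow : ∀ ξ, ξ₀ ≤ ξ → w ξ₀ - K / r * Real.exp (-r * ξ₀) ≤ w ξ := by
    intro ξ hξ
    have hcont : ContinuousOn (fun x => w x - w ξ₀) (Icc ξ₀ ξ) := by
      intro x hx
      have hx' : a < x := by rw [hξ₀] at hx; linarith [hx.1]
      exact ((hwd x hx').continuousAt.sub continuousAt_const).continuousWithinAt
    have key := image_norm_le_of_norm_deriv_right_le_deriv_boundary (f := fun x => w x - w ξ₀)
      (a := ξ₀) (b := ξ) (f' := fun x => deriv w x) hcont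
      (fun x hx => by
        have hx' : a < x := by rw [hξ₀] at hx; linarith [hx.1]
        exact ((hwd x hx').hasDerivAt.sub_const _).hasDerivWithinAt)
      (B := B) (B' := fun x => K * Real.exp (-r * x)) (by simp [hB]) hB'
      (fun x hx => hderiv_bound x (by rw [hξ₀] at hx; linarith [hx.1])) (right_mem_Icc.2 hξ)
    have h1 : |w ξ - w ξ₀| ≤ B ξ := by simpa [Real.norm_eq_abs] using key
    rw [abs_le] at h1
    have h2 : B ξ ≤ K / r * Real.exp (-r * ξ₀) := by
      simp only [hB]
      have : 0 ≤ K / r * Real.exp (-r * ξ) := by positivity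
      linarith
    linarith [h1.1]
  -- conclusion
  refine ⟨ξ₀, Real.exp (w ξ₀ - K / r * Real.exp (-r * ξ₀)), Real.exp_pos _, fun ξ hξ => ?_⟩
  have h1 := hlow ξ hξ.le
  have h2 : 𝒮 ξ = Real.exp (w ξ) * Real.exp (-r * ξ) := by
    rw [← Real.exp_add, hw]
    simp only
    rw [show Real.log (𝒮 ξ) + r * ξ + -r * ξ = Real.log (𝒮 ξ) by ring, Real.exp_log (h𝒮pos ξ)]
  show _ ≤ 𝒮 ξ
  rw [h2]
  exact mul_le_mul_of_nonneg_right (Real.exp_le_exp.2 h1) (Real.exp_pos _).le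

/-- **Two-sided far-field asymptotics of the profile density: `S(ζ) ≥ c ζ^{1−r}`.** For profiles
as in the vendored fact (`S > 0`) with `1 < r < 2` there are `ζ₀ > 0` and `c > 0` with
`c ζ^{1−r} ≤ S(ζ)` for `ζ ≥ ζ₀` (with `logProfile_sharp`: `S ≍ ζ^{1−r}`).
[cite: CaolaboraEtAl2025, Thm 1.2 p. 6, eq. (1.6) p. 6] [cite: BuckmasterCaolaboraGomezserrano2025, Thm 1.1 p. 4] -/
theorem profile_soundSpeed_lower (hr1 : 1 < r) (hr2 : r < 2)
    (hU : ContDiff ℝ ∞ fun y : V3 => (U ‖y‖ / ‖y‖) • y) (hS : ContDiff ℝ ∞ fun y : V3 => S ‖y‖)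
    (hode : ∀ ζ : ℝ, 0 < ζ →
      (r - 1) * U ζ + (ζ + U ζ) * deriv U ζ + 1 / 3 * S ζ * deriv S ζ = 0 ∧
      (r - 1) * S ζ + (ζ + U ζ) * deriv S ζ + 1 / 3 * S ζ * (deriv U ζ + 2 * U ζ / ζ) = 0)
    (hSpos : ∀ ζ : ℝ, 0 ≤ ζ → 0 < S ζ)
    (hlimU : Tendsto (fun ζ => U ζ / ζ) atTop (𝓝 0))
    (hlimS : Tendsto (fun ζ => S ζ / ζ) atTop (𝓝 0)) :
    ∃ ζ₀ c : ℝ, 0 < ζ₀ ∧ 0 < c ∧ ∀ ζ, ζ₀ ≤ ζ → c * ζ ^ (1 - r) ≤ S ζ := by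
  obtain ⟨a, c, hc, h⟩ := logSoundSpeed_lower hr1 hr2 hU hS hode hSpos hlimU hlimS
  refine ⟨Real.exp a + 1, c, by positivity, hc, fun ζ hζ => ?_⟩
  have hζ0 : 0 < ζ := (Real.exp_pos a).trans (by linarith)
  have hlog : a < Real.log ζ := (Real.lt_log_iff_exp_lt hζ0).2 (by linarith)
  have h1 := h (Real.log ζ) hlog
  rw [Real.exp_log hζ0, Real.exp_neg, Real.exp_log hζ0] at h1
  -- `c e^{-r log ζ} ≤ ζ⁻¹ S ζ`  ⇒  `c ζ^{1-r} ≤ S ζ`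
  have h2 : Real.exp (-r * Real.log ζ) = ζ ^ (-r) := by
    rw [show -r * Real.log ζ = Real.log ζ * (-r) by ring, ← Real.rpow_def_of_pos hζ0]
  rw [h2] at h1
  have h3 : c * ζ ^ (1 - r) = ζ * (c * ζ ^ (-r)) := by
    rw [show (1 - r : ℝ) = 1 + -r by ring, Real.rpow_add hζ0, Real.rpow_one]
    ring
  rw [h3]
  calc ζ * (c * ζ ^ (-r)) ≤ ζ * (ζ⁻¹ * S ζ) := mul_le_mul_of_nonneg_left h1 hζ0.le
    _ = S ζ := by field_simp

end Lower

end CaolaboraEtAl2025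

end Literature.Analysis.FluidPDE
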